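import Summits.AnomalousDissipation.AnomalousDissipation.Theses.HopfSnake
import Literature.Analysis.FluidPDE.TorusClassicalLerayHopfProofs
import Literature.Analysis.FluidPDE.DoeringFoiasAmplitudeProofs
import Literature.Analysis.FluidPDE.EulerReynolds

/-!
# Route HopfSnake — typed decomposition of the deciding crux `BoundedLoudSnake`
(stmt-AnomalousDissipation-1802) along the Doering–Foias seam

`BoundedLoudSnake` (a bounded LOUD viscosity snake of time-periodic classical solutions exists for
one smooth steady force on `T³`) is the sole binder of the route's deciding theorem `closes`, hence
at least as strong as the summit.  This file PROVES the assembly of the two-piece decomposition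

* `BoundedSnakeToZero3D` (item stmt-AnomalousDissipation-10640, unchanged): a bounded (d)-snake of a
  genuinely three-dimensional force exists (dynamics / selection; says nothing about dissipation);
* `SnakesSaturateDoeringFoias3D` (new piece, stated inline below exactly as filed): KOLMOGOROV'S
  DIMENSIONLESS DISSIPATION LAW ALONG BOUNDED SNAKES — for every genuinely three-dimensional smooth
  steady divergence-free mean-zero `f` and every bounded (d)-snake `s ↦ (ν s, u s, p s)` of
  `NS_{ν(s)}(f)` there is `β > 0` with `ε(s) ≥ β U(s)³` at arbitrarily small `ν(s)`
  (`ε(s) = meanDissipation (ν s) (u s)`, `U(s) = rmsVelocity longTimeAvgSup (u s) = ⟨‖u(s)‖₂²⟩^{1/2}`),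
  i.e. the dissipation coefficient `C_ε = εℓ/U³` (`ℓ = 1`) does not vanish along the tail — the
  zeroth law in its scale-free (Frisch / Doering–Foias / Cheskidov Thm 1.3 `εⱼ ≥ cUⱼ³`) form, which by
  itself gives NO dissipation floor (it is compatible with `U(s) → 0`);

into the target:  `BoundedSnakeToZero3D → SnakesSaturateDoeringFoias3D → BoundedLoudSnake`.

The seam is the one rigorous piece of the Doering–Foias theory that bears on a LOWER bound: along
any family of global Leray–Hopf solutions driven by a FIXED non-zero steady force the r.m.s. velocity
cannot collapse as `ν → 0`.  Proof of the assembly: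
1. the three-dimensionality side condition (`f` has no continuous translation symmetry) forces
   `f ≠ 0`, hence `F := ‖f‖_{L²} > 0` (a smooth field with `∫‖f‖² = 0` vanishes identically);
2. `Φ := F⁻¹ f` is a Doering–Foias forcing shape (smooth, divergence free, mean zero, `‖Φ‖₂ = 1`)
   with `Φ.force 1 F = f`;
3. every snake member `u(s)` is a global Leray–Hopf solution from its own datum (discharged fact
   `Torus.isGlobalLerayHopf_of_isClassicalNSSolutionOn`, used through its proof), so the DISCHARGED
   Doering–Foias amplitude bound (`DoeringFoias2002_amplitude_le_holds`; Cheskidov–Doering–Petrov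
   2007 eqs. (18)–(19), Doering–Foias 2002 §3: momentum equation tested against the force,
   integration by parts, time average) gives `F ≤ a U(s)² + b ν(s) U(s)` for all `s`, with
   `a, b > 0` depending on `Φ` only;
4. with the snake's energy bound `U(s) ≤ R := (max E 1)^{1/2}`: for `ν(s) < ν₁ := F/(2bR)` one gets
   `a U(s)² ≥ F/2`, i.e. `U(s) ≥ U_m := (F/(2a))^{1/2} > 0`;
5. the law at viscosity threshold `min ν₀ ν₁` yields `s` with `ν(s) < ν₀` and
   `ε(s) ≥ β U(s)³ ≥ β U_m³ =: ε₀ > 0` — the loudness clause of `BoundedLoudSnake`, uniformly in `ν₀`.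

References: C. R. Doering, C. Foias, J. Fluid Mech. 467 (2002) §§2–3 [DoeringFoias2002];
A. Cheskidov, C. R. Doering, N. P. Petrov, J. Math. Phys. 48 (2007), arXiv:physics/0607280,
§III (18)–(19) [CheskidovDoeringPetrov2006]; A. Cheskidov, arXiv:2311.04182, Thm 1.3 (the `εⱼ ≥ cUⱼ³`
clause) [Cheskidov2023]; U. Frisch, *Turbulence* (1995) §5.2 [Frisch1995].
-/

-- `Summit.<Summit>.<Problem>` is the tree's mandated summit-side namespace (CONVENTIONS §2); for this
-- single-conjunct summit the two coincide, so the duplicate is deliberate.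
set_option linter.dupNamespace false

noncomputable section

open scoped BigOperators Topology InnerProductSpace
open Filter Set Function MeasureTheory

namespace Summit.AnomalousDissipation.AnomalousDissipation.Theorems.HopfSnake.BoundedLoudSnakeSplit

open Literature.Analysis.FunctionSpaces Literature.Analysis.FunctionSpaces.Torus
open Literature.Analysis.FluidPDE
open Summit.AnomalousDissipation.AnomalousDissipation.Theses.HopfSnake

/-! ### Step 1: a genuinely three-dimensional force is not zero, and has positive `L²` norm -/

/-- A field with no continuous translation symmetry (the route's three-dimensionality side
condition) is not the zero field. [folklore] -/
theorem ne_zero_of_noTranslationSymmetry {f : UnitAddTorus (Fin 3) → EuclideanSpace ℝ (Fin 3)}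
    (h3d : ∀ k : EuclideanSpace ℝ (Fin 3), k ≠ 0 →
      ∃ τ : ℝ, ∃ x, f (x + Literature.Analysis.FunctionSpaces.Torus.proj (τ • k)) ≠ f x) :
    f ≠ 0 := by
  rintro rfl
  have hk : (EuclideanSpace.single (0 : Fin 3) (1 : ℝ)) ≠ 0 := by
    intro h
    have := congrArg (fun v : EuclideanSpace ℝ (Fin 3) => v 0) h
    simp at this
  obtain ⟨τ, x, hx⟩ := h3d _ hk
  exact hx rfl

/-- A smooth field which does not vanish identically has `0 < ∫‖f‖²` (a continuous non-negative
function with zero integral vanishes: the Haar measure of the torus charges open sets). [folklore] -/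
theorem integral_norm_sq_pos_of_isSmooth {f : UnitAddTorus (Fin 3) → EuclideanSpace ℝ (Fin 3)}
    (hfs : IsSmooth f) (hf0 : f ≠ 0) : 0 < ∫ x, ‖f x‖ ^ 2 := by
  have hint : Integrable (fun x => ‖f x‖ ^ 2) volume :=
    (memLp_two_iff_integrable_sq_norm (hfs.memLp 2).1).1 (hfs.memLp 2)
  refine lt_of_le_of_ne (integral_nonneg fun x => by positivity) fun h => hf0 ?_
  have hae := (integral_eq_zero_iff_of_nonneg (f := fun x => ‖f x‖ ^ 2) (fun x => by positivity)
    hint).1 h.symm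
  have heq : (fun x => ‖f x‖ ^ 2) = fun _ => (0 : ℝ) :=
    (Continuous.ae_eq_iff_eq volume (hfs.continuous.norm.pow 2) continuous_const).1 hae
  funext x
  have hx := congrFun heq x
  simpa using hx

/-! ### Step 2: the Doering–Foias forcing shape of a non-zero smooth steady force -/

/-- A smooth divergence-free mean-zero field `f` with `F := ‖f‖₂ > 0` is the Doering–Foias force
`F Φ(1 • ·)` of the normalised shape `Φ = F⁻¹ f`. [folklore] -/
theorem exists_forcingShape_force_eq {f : UnitAddTorus (Fin 3) → EuclideanSpace ℝ (Fin 3)}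
    (hfs : IsSmooth f) (hdiv : IsDivFree f) (hmean : HasZeroMean f)
    (hF2 : 0 < ∫ x, ‖f x‖ ^ 2) :
    ∃ Φ : ForcingShape (Fin 3), Φ.force 1 (Real.sqrt (∫ x, ‖f x‖ ^ 2)) = f := by
  set F : ℝ := Real.sqrt (∫ x, ‖f x‖ ^ 2) with hFdef
  have hF : 0 < F := Real.sqrt_pos.2 hF2
  have hsq : ∀ x, ‖(F⁻¹ • f) x‖ ^ 2 = (F ^ 2)⁻¹ * ‖f x‖ ^ 2 := by
    intro x
    rw [Pi.smul_apply, norm_smul, mul_pow, Real.norm_eq_abs, abs_inv, abs_of_pos hF, inv_pow]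
  refine ⟨{ shape := F⁻¹ • f
            smooth := hfs.smul _
            divFree := fun x => by
              rw [Literature.Analysis.FluidPDE.Torus.divergence_const_smul
                (hfs.isContDiff (by exact_mod_cast le_top)), hdiv x, mul_zero]
            zeroMean := by
              unfold HasZeroMean at hmean ⊢
              simp [integral_smul, hmean]
            sq_norm_eq_one := by
              simp_rw [hsq]
              rw [integral_const_mul, hFdef, Real.sq_sqrt hF2.le, inv_mul_cancel₀ hF2.ne'] }, ?_⟩
  funext x
  simp [ForcingShape.force, smul_smul, hF.ne']

/-! ### Steps 3–5: the assembly -/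

/-- **Typed decomposition of the deciding crux `BoundedLoudSnake` (stmt-AnomalousDissipation-1802)
of route HopfSnake — the assembly, proved.**  `BoundedSnakeToZero3D → SnakesSaturateDoeringFoias3D →
BoundedLoudSnake`: the bounded (d)-snake of a genuinely three-dimensional force supplied by the
selection piece, together with Kolmogorov's DIMENSIONLESS dissipation law `ε(s) ≥ β U(s)³`
(cofinally as `ν(s) → 0`) along bounded snakes of such forces, is a bounded LOUD snake.  The second
hypothesis is the new piece `SnakesSaturateDoeringFoias3D` (item stmt-AnomalousDissipation-17647) BY NAME.  The proof is the
Doering–Foias lower bound on the r.m.s. velocity for a fixed non-zero force (steps 1–5 of the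
module docstring): `f ≠ 0` by three-dimensionality, `Φ = f/‖f‖₂` a forcing shape,
`‖f‖₂ ≤ a U² + b ν U` for every snake member (discharged `DoeringFoias2002_amplitude_le_holds` on
the global Leray–Hopf solutions `u(s)`), hence `U(s) ≥ (‖f‖₂/(2a))^{1/2}` once
`ν(s) < ‖f‖₂/(2bR)`, `R² = max E 1`, and `ε(s) ≥ β U(s)³ ≥ β(‖f‖₂/(2a))^{3/2} =: ε₀`. -/
theorem boundedLoudSnake_of_pieces (h₁ : BoundedSnakeToZero3D)
    (h₂ : SnakesSaturateDoeringFoias3D) :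
    BoundedLoudSnake := by
  obtain ⟨f, hf, hdiv, hmean, h3d, ν, u, p, hsnake, E, hE⟩ := h₁
  obtain ⟨β, hβ, hlaw⟩ := h₂ f hf hdiv hmean h3d ν u p hsnake ⟨E, hE⟩
  -- Step 1: the force is non-zero, `F = ‖f‖₂ > 0`
  have hF2 : 0 < ∫ x, ‖f x‖ ^ 2 :=
    integral_norm_sq_pos_of_isSmooth hf (ne_zero_of_noTranslationSymmetry h3d)
  set F : ℝ := Real.sqrt (∫ x, ‖f x‖ ^ 2) with hFdef
  have hF : 0 < F := Real.sqrt_pos.2 hF2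
  -- Step 2: the forcing shape
  obtain ⟨Φ, hΦ⟩ := exists_forcingShape_force_eq hf hdiv hmean hF2
  -- Step 3: the Doering–Foias amplitude bound along the snake
  obtain ⟨a, b, ha, hb, hamp⟩ := DoeringFoias2002_amplitude_le_holds Φ
  have hsol := hsnake.2.2.1
  have hU0 : ∀ s, 0 ≤ rmsVelocity longTimeAvgSup (u s) := fun s => Real.sqrt_nonneg _
  have hDF : ∀ s, F ≤ a * rmsVelocity longTimeAvgSup (u s) ^ 2
      + b * ν s * rmsVelocity longTimeAvgSup (u s) := by
    intro s
    have hLH : Literature.Analysis.FluidPDE.Torus.IsGlobalLerayHopf (ν s) (fun _ => Φ.force 1 F)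
        (u s 0) (u s) := by
      rw [hΦ]
      exact (hsol s).2.1.isGlobalLerayHopf
    have h := hamp (hsol s).1 (n := 1) one_pos F (u s 0) (u s) hLH
    rw [abs_of_pos hF] at h
    simpa using h
  -- Step 4: the energy bound and the lower bound on `U` at small viscosity
  set R : ℝ := Real.sqrt (max E 1) with hRdef
  have hR : 0 < R := Real.sqrt_pos.2 (lt_of_lt_of_le one_pos (le_max_right _ _))
  have hUR : ∀ s, rmsVelocity longTimeAvgSup (u s) ≤ R := fun s => by
    rw [rmsVelocity_eq_sqrt_meanEnergy]
    exact Real.sqrt_le_sqrt ((hE s).trans (le_max_left _ _))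
  set ν₁ : ℝ := F / (2 * b * R) with hν₁def
  have hν₁ : 0 < ν₁ := by positivity
  set Um : ℝ := Real.sqrt (F / (2 * a)) with hUmdef
  have hUm : 0 < Um := Real.sqrt_pos.2 (by positivity)
  have hUlow : ∀ s, ν s < ν₁ → Um ≤ rmsVelocity longTimeAvgSup (u s) := by
    intro s hs
    have hν0 : 0 < ν s := (hsol s).1
    have h1 : b * ν s * rmsVelocity longTimeAvgSup (u s) ≤ b * ν₁ * R :=
      mul_le_mul (mul_le_mul_of_nonneg_left hs.le hb.le) (hUR s) (hU0 s) (by positivity)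
    have h2 : b * ν₁ * R = F / 2 := by
      rw [hν₁def]
      field_simp
    have h3 : F / 2 ≤ a * rmsVelocity longTimeAvgSup (u s) ^ 2 := by linarith [hDF s]
    have h4 : F / (2 * a) ≤ rmsVelocity longTimeAvgSup (u s) ^ 2 := by
      rw [div_le_iff₀ (by positivity)]
      linarith
    calc Um = Real.sqrt (F / (2 * a)) := rfl
      _ ≤ Real.sqrt (rmsVelocity longTimeAvgSup (u s) ^ 2) := Real.sqrt_le_sqrt h4
      _ = rmsVelocity longTimeAvgSup (u s) := Real.sqrt_sq (hU0 s)
  -- Step 5: the loud tail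
  refine ⟨f, hf, hdiv, hmean, ν, u, p, hsnake, ⟨E, hE⟩, β * Um ^ 3, by positivity, ?_⟩
  intro ν₀ hν₀
  obtain ⟨s, hs, hβs⟩ := hlaw (min ν₀ ν₁) (lt_min hν₀ hν₁)
  refine ⟨s, hs.trans_le (min_le_left _ _), ?_⟩
  have hUs : Um ≤ rmsVelocity longTimeAvgSup (u s) := hUlow s (hs.trans_le (min_le_right _ _))
  calc β * Um ^ 3 ≤ β * rmsVelocity longTimeAvgSup (u s) ^ 3 := by gcongr
    _ ≤ meanDissipation (ν s) (u s) := hβs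

/-- **The glue item `BoundedLoudSnakeOfPieces` of route HopfSnake, closed** (support item filed by the
crux-strategist 2026-08-17): `BoundedSnakeToZero3D → SnakesSaturateDoeringFoias3D → BoundedLoudSnake`. -/
theorem boundedLoudSnakeOfPieces_proof : BoundedLoudSnakeOfPieces :=
  fun h₁ h₂ => boundedLoudSnake_of_pieces h₁ h₂

end Summit.AnomalousDissipation.AnomalousDissipation.Theorems.HopfSnake.BoundedLoudSnakeSplit

end
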